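import Summits.BirchSwinnertonDyer.BirchSwinnertonDyer.Theses.DefiniteTheta
import Literature.NumberTheory.Automorphic.BrandtSetupAdmissible
import HarnessLib

/-!
# Line `birth` — birth skeleton for crux `DefiniteExactOrder` (stmt-BirchSwinnertonDyer-18437)

Crux (route DefiniteTheta #2, rank 2, the deciding crux of the route): **every globally minimal
elliptic `V/ℚ` with a prime of multiplicative reduction admits an ADMISSIBLE DEFINITE DATUM
`(p, N⁺, N⁻, K, S, T, φ)` at which the anticyclotomic order of vanishing of the definite theta
element at the `p`-adic unit root is `≤ r_an(V)` in `ℕ∞`** (the `≤` half of BD96 Conj. 4.1 with the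
twist rank pushed below `r_an(V)` by the choice of `K`).

## The cut (planner skeleton registrar, 2026-08-17): supply ⟶ realise ⟶ bound

The crux is an `∃`-statement whose witness has two halves of very different nature — an
ARITHMETIC half `(p, K, N⁺, N⁻)` (a sharp auxiliary prime and an auxiliary imaginary quadratic
field with prescribed splitting and SMALL TWIST RANK) and a QUATERNIONIC half `(S, T, φ)` (an
Eichler order of level `N⁺` in the definite quaternion algebra of discriminant `N⁻`, a tower of
Gross points of `p`-power conductor, a generator of the `f_E`-eigen-line of the Brandt module) —
followed by ONE inequality, the open content. The skeleton cuts exactly there (the route header's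
two-layer plan "DefiniteExactOrder ⇐ SupplyMinimalTwist → Conj41Upper", with the supply split into
its analytic and its quaternionic half because they are discharged by disjoint tool-kits):

* stub **A1** `stub_sharpAuxSupply` (LITERATURE ASSEMBLY, size L): for `V` with a multiplicative
  prime `q₀` there are `p, N⁺, N⁻, K` with ALL the crux's side conditions on `(p, K, N⁺, N⁻)`,
  `N⁻` squarefree, and `r_an(V^{d_K}) ≤ r_an(V)`. Truth sketch: `N⁻ := q₀` (so `q₀ ‖ N`,
  `ω(N⁻) = 1` odd, `gcd(N⁺, N⁻) = 1`), `K` imaginary quadratic with `q₀` inert, every prime of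
  `N⁺` split, `d_K < −4`, `(d_K, N) = 1`: then `ε(V/K) = +1`, i.e. `w(V^{d_K}) = w(V)`, and
  Friedberg–Hoffstein 1995 Thm. B (non-vanishing of `L(V ⊗ χ_d, 1)`, resp. `L'(V ⊗ χ_d, 1)`, for
  infinitely many `d` with PRESCRIBED local behaviour at the primes of `N`) gives such a `K` with
  `r_an(V^{d_K}) = r_an(V) mod 2 ∈ {0, 1}`, hence `≤ r_an(V)`; then `p` is chosen last and large:
  `p ≥ 7`, `p ∤ N d_K h_K ∏_{q ∣ N}(q² − 1)`, `ρ̄_{V,p}` surjective (Serre 1972, `V` is non-CM since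
  it has a multiplicative prime; `serre_open_image_holds` in tree) and `a_p ∉ {0, ±1}` (a density-one
  set of `p` by Serre 1981 Thm. 20; for `p ≥ 7`, `p ∣ a_p (a_p² − 1)` iff `a_p ∈ {0, ±1}` by Hasse).
  The tree's Heegner-field supply facts (`bumpFriedbergHoffstein_…`, `murtyMurty_…`,
  `waldspurger_exists_heegnerField_…`) are ALL-SPLIT; the inert condition at `q₀` is why this is a
  stub and not a by-name fact.
* stub **A2** `stub_brandtGrossRealisation` (LITERATURE ASSEMBLY, size L): at such `(V, p, K, N⁺,
  N⁻)` (only: `p` good, `K` imaginary quadratic with `(d_K, Np) = 1`, `N = N⁺N⁻` coprime, `N⁻`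
  squarefree with `ω(N⁻)` odd, `N⁺`-primes split, `N⁻`-primes inert) there exist a Brandt setup `S`
  of type `(N⁺, N⁻)` (PROVED in tree: `Brandt.nonempty_xiSetup_iff_admissible`, see
  `exists_xiSetup` below), a tower of Gross points of conductor `pⁿ` on it (BD96 Lemma 2.2 + §2.4;
  Vignéras III.5.11–5.13 optimal embeddings — the tree fact `nonempty_grossPointTower` is typed for
  squarefree `N` only, the datum allows `q² ∣ N⁺`), and a generator `φ ≠ 0` of the `a(V)`-eigen-line
  `eigenLattice N (Brandt.matrix S.O) (a_n(V)) = ℤ ∙ φ` (modularity + Jacquet–Langlands to the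
  definite algebra of discriminant `N⁻` — `V` is Steinberg at `q₀ ‖ N` — + strong multiplicity one:
  the prime-to-`N` eigen-system of `f_V` cuts a LINE in the Brandt module of the Eichler order of
  level `N⁺`; Eichler 1973 / Hijikata–Pizer–Shemanske 1989 basis problem; tree lemma
  `Brandt.exists_eigenLattice_eq_span_of_finrank_eigenSpace_eq_one` turns `dim_ℚ = 1` into
  `ℤ ∙ φ`).
* stub **B** `stub_conj41UpperAnalytic` (OPEN, load-bearing): at EVERY admissible definite datum
  (the crux's side conditions, universally quantified, exactly the binder block of the sibling crux
  `DerivedHeightCap`): `ord_J θ_∞^{ac}(V, K) ≤ max (r_an(V), r_an(V^{d_K}))` in `ℕ∞` — the `≤`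
  HALF OF BERTOLINI–DARMON 1996 CONJ. 4.1 in the definite case (`ρ = max(r̃⁺, r̃⁻)`, p. 445; in the
  non-exceptional case `r̃± = r±`, §1.10) in analytic-rank form (`r⁺ + r⁻ = r_an(V/K) =
  r_an(V) + r_an(V^{d_K})` by BSD-rank-free bookkeeping is NOT used: the stub is stated with
  analytic ranks throughout, so no Mordell–Weil rank enters the skeleton). Known: `max = 0`
  (Gross's special value formula: `θ_∞(𝟙) ≠ 0 ⟺ L(V/K, 1) ≠ 0`); open from `max ≥ 1` (BD95 §3
  derived heights; Howard 2004 derived `p`-adic heights; the `≥` half is BD05 Cor. 3).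
  Why it might fail: accidental extra vanishing of `θ^{ac}` at SOME admissible `(K, p)` — the stub
  is universal in the datum while the crux only needs one; the catalogued barrier
  `AnticyclotomicHeightDegeneracy` is exactly this slack.

`DefiniteExactOrder_of (hA1 : Statement.stub_sharpAuxSupply) (hA2 : …) (hB : …) :
DefiniteTheta.DefiniteExactOrder` (sorry-free; stub statements BY NAME via `type_of%` abbrevs):
A1 supplies `(p, N⁺, N⁻, K)` with the side conditions, `Squarefree N⁻` and the twist-rank
inequality; A2 supplies `(S, T, φ)`; B bounds `ord θ ≤ max(r_an V, r_an V^{d_K}) = r_an V`.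
`DefiniteExactOrder_proof` plugs the sorried stubs in. No stub is the crux or the summit reworded:
A1 and A2 contain no theta element (pure supply: analytic number theory resp. quaternionic
arithmetic, both theorems in print), B contains no existential (it is the conjecture-half the
route bets on, at a FIXED datum, and does not imply the crux without the supply).

## BC3 self-audit (planner, 2026-08-17)

See `Lines/birth.md`: `lean check` rc 0, sorries = 3 = stubs, zero elsewhere; the six probes
`stub_X → DefiniteExactOrder` / `stub_X → BirchSwinnertonDyer` by
`first | exact? | simpa [Statement.stub_X] | aesop` all FAIL.
-/

set_option linter.dupNamespace false

namespace Summit.BirchSwinnertonDyer.BirchSwinnertonDyer.Cruxes.DefiniteExactOrder.Birth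

open scoped BigOperators Topology Manifold Classical MeasureTheory ProbabilityTheory Matrix InnerProductSpace ComplexConjugate ContinuousMap
open Filter Set Function TopologicalSpace MeasureTheory
open Literature
open Literature.NumberTheory.EllipticCurves Literature.NumberTheory.Automorphic
open Summit.BirchSwinnertonDyer.BirchSwinnertonDyer.Theses.DefiniteTheta (DefiniteExactOrder)

/-! ### The three stubs -/

/-- Stub **A1** (literature assembly): SHARP AUXILIARY SUPPLY WITH SMALL TWIST RANK. For a globally
minimal elliptic `V/ℚ` with a prime `q₀` of multiplicative reduction there are a prime `p`, a
factorisation type `(N⁺, N⁻)` of `N_V` and an imaginary quadratic field `K` satisfying every side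
condition of the crux on `(p, K, N⁺, N⁻)` — `p ≥ 7` good, `a_p ∉ {0, ±1} (mod p)`, `ρ̄_{V,p}`
surjective, `p ∤ q² − 1` for `q ∣ N`, `p ∤ h_K`; `[K:ℚ] = 2` totally complex, `d_K < −4`,
`(d_K, N p) = 1`; `N = N⁺N⁻` coprime, `ω(N⁻)` odd, `N⁺`-primes split and `N⁻`-primes inert in `K` —
together with `N⁻` squarefree and `r_an(V^{d_K}) ≤ r_an(V)`. Assembly in print: take `N⁻ = q₀`;
Friedberg–Hoffstein 1995 Thm. B (quadratic twists with prescribed local components, `L` and `L'`)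
gives `K` with `r_an(V^{d_K}) ∈ {0,1}` of the parity of `r_an(V)` (`ε(V/K) = +1` for this splitting
type); Serre's open image theorem and the density-zero of `{p : a_p ∈ {0, ±1}}` (Serre 1981) give
`p`. [cite: FriedbergHoffstein1995, Thm. B] [cite: Serre1972, Thm. 2] [cite: Serre1981, Thm. 20] -/
theorem stub_sharpAuxSupply :
    ∀ (V : WeierstrassCurve ℚ) [V.IsElliptic] [V.IsGloballyMinimal],
      (∃ (q : ℕ) (_ : Fact q.Prime), V.HasMultiplicativeReductionAtPrime q) →
        ∃ (p : ℕ) (_ : Fact p.Prime) (Nplus Nminus : ℕ) (K : Type) (_ : Field K)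
          (_ : NumberField K),
          (7 ≤ p ∧ V.HasGoodReductionAtPrime p ∧ ¬ (p : ℤ) ∣ V.frobeniusTrace p ∧
              ¬ (p : ℤ) ∣ (V.frobeniusTrace p) ^ 2 - 1 ∧ V.HasSurjectiveModNGaloisRep p ∧
              (∀ q : ℕ, q.Prime → q ∣ V.conductorNorm ℤ → ¬ (p : ℤ) ∣ (q : ℤ) ^ 2 - 1) ∧
              ¬ p ∣ NumberField.classNumber K) ∧
          (Module.finrank ℚ K = 2 ∧ NumberField.IsTotallyComplex K ∧ NumberField.discr K < -4 ∧
              Int.gcd (NumberField.discr K) (V.conductorNorm ℤ * p) = 1) ∧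
          (V.conductorNorm ℤ = Nplus * Nminus ∧ Nat.Coprime Nplus Nminus ∧
              Odd Nminus.primeFactors.card ∧
              (∀ q : ℕ, q.Prime → q ∣ Nplus →
                ((Ideal.span {(q : ℤ)}).primesOver (NumberField.RingOfIntegers K)).ncard = 2) ∧
              (∀ q : ℕ, q.Prime → q ∣ Nminus →
                ((Ideal.span {(q : ℤ)}).primesOver (NumberField.RingOfIntegers K)).ncard = 1)) ∧
          Squarefree Nminus ∧
          (V.quadraticTwist (NumberField.discr K : ℚ)).analyticRank ≤ V.analyticRank := by
  sorry

/-- Stub **A2** (literature assembly): BRANDT–GROSS REALISATION. At `(V, p, K, N⁺, N⁻)` with `p`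
good for `V`, `K` imaginary quadratic with `(d_K, N p) = 1`, `N_V = N⁺N⁻` coprime, `N⁻` squarefree
with `ω(N⁻)` odd, every prime of `N⁺` split and every prime of `N⁻` inert in `K`, there exist: a
Brandt setup `S` of type `(N⁺, N⁻)` (Vignéras III §3 Thm. 3.1; PROVED in tree,
`Brandt.nonempty_xiSetup_iff_admissible`), a tower of Gross points of conductor `pⁿ` on its
definite Shimura set (Bertolini–Darmon 1996 Lemma 2.2 and §2.4: optimal embeddings of `𝒪_{pⁿ}`
into an Eichler order of level `N⁺` exist since `N⁺`-primes split, `N⁻`-primes are inert and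
`p ∤ N`), and a generator `φ ≠ 0` of the `a(V)`-eigen-line of the Brandt module,
`eigenLattice N (Brandt.matrix S.O) (a_n V) = ℤ ∙ φ` (modularity; Jacquet–Langlands transfer to the
definite algebra of discriminant `N⁻`, where `V` is Steinberg; strong multiplicity one away from
`N`; Eichler's basis problem, Hijikata–Pizer–Shemanske 1989 for general level `N⁺`; the tree lemma
`Brandt.exists_eigenLattice_eq_span_of_finrank_eigenSpace_eq_one`). [cite: BertoliniDarmon1996, Lemma 2.2 and §2.4] [cite: HijikataPizerShemanske1989, Thm. 7.8] [cite: VignerasLNM800, Ch. III §5 Cor. 5.12] -/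
theorem stub_brandtGrossRealisation :
    ∀ (V : WeierstrassCurve ℚ) [V.IsElliptic] [V.IsGloballyMinimal] (p : ℕ) [Fact p.Prime]
      (Nplus Nminus : ℕ) (K : Type) [Field K] [NumberField K],
      V.HasGoodReductionAtPrime p → Module.finrank ℚ K = 2 → NumberField.IsTotallyComplex K →
        Int.gcd (NumberField.discr K) (V.conductorNorm ℤ * p) = 1 →
          V.conductorNorm ℤ = Nplus * Nminus → Nat.Coprime Nplus Nminus → Squarefree Nminus →
            Odd Nminus.primeFactors.card →
              (∀ q : ℕ, q.Prime → q ∣ Nplus →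
                ((Ideal.span {(q : ℤ)}).primesOver (NumberField.RingOfIntegers K)).ncard = 2) →
                (∀ q : ℕ, q.Prime → q ∣ Nminus →
                  ((Ideal.span {(q : ℤ)}).primesOver (NumberField.RingOfIntegers K)).ncard = 1) →
                  ∃ (S : Brandt.XiSetup Nplus Nminus) (_ : Fintype (Brandt.ClassSet S.O))
                    (T : GrossPointTower K S p) (φ : Brandt.ClassSet S.O → ℤ),
                    φ ≠ 0 ∧
                      Brandt.eigenLattice (Nplus * Nminus) (Brandt.matrix S.O)
                          (fun n => V.LFunction n) = Submodule.span ℤ {φ} := by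
  sorry

/-- Stub **B** (OPEN — the load-bearing stub): THE `≤` HALF OF BERTOLINI–DARMON 1996 CONJ. 4.1,
DEFINITE CASE, IN ANALYTIC-RANK FORM. At EVERY admissible definite datum `(V, p, N⁺, N⁻, K, S, T,
φ)` (the side conditions of the crux, universally quantified — verbatim the binder block of the
sibling crux `DerivedHeightCap`), the anticyclotomic order of vanishing of the theta element at the
unit root `α_p` satisfies `ord_J θ_∞^{ac} ≤ max (r_an(V), r_an(V^{d_K}))` in `ℕ∞`. BD96 Conj. 4.1
(p. 445: "in the definite case `ρ = max(r̃⁺, r̃⁻)`"; non-exceptional, so `r̃± = r±`, §1.10) asserts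
equality with Mordell–Weil ranks; granting parity/BSD bookkeeping `{r⁺, r⁻} = {r_an(V),
r_an(V^{d_K})}`, this stub is its upper-bound half. Known: the case `max = 0` (Gross 1987 special
value formula, `θ_∞(𝟙)² ≐ L(V/K,1)/Ω`); the LOWER bound `ord ≥ max` in many cases (BD05 Cor. 3).
Open from `max ≥ 1`: the leading coefficient is a DERIVED anticyclotomic `p`-adic height
(BD95 §3, Howard 2004), whose non-degeneracy nobody controls. Why it might fail: accidental extra
vanishing at SOME admissible `(K, p)` (barrier `AnticyclotomicHeightDegeneracy`); the crux needs
only one datum, the stub claims all. [cite: BertoliniDarmon1996, Conj. 4.1] [cite: BertoliniDarmon1995, §3] [cite: Howard2004DerivedHeights, Thm. A] -/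
theorem stub_conj41UpperAnalytic :
    ∀ (V : WeierstrassCurve ℚ) [V.IsElliptic] [V.IsGloballyMinimal] (p : ℕ) [Fact p.Prime]
      (Nplus Nminus : ℕ) (K : Type) [Field K] [NumberField K]
      (S : Literature.NumberTheory.Automorphic.Brandt.XiSetup Nplus Nminus)
      [Fintype (Literature.NumberTheory.Automorphic.Brandt.ClassSet S.O)]
      (T : Literature.NumberTheory.EllipticCurves.GrossPointTower K S p)
      (φ : Literature.NumberTheory.Automorphic.Brandt.ClassSet S.O → ℤ),
      ((7 ≤ p ∧ V.HasGoodReductionAtPrime p ∧ ¬ (p : ℤ) ∣ V.frobeniusTrace p ∧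
            ¬ (p : ℤ) ∣ (V.frobeniusTrace p) ^ 2 - 1 ∧ V.HasSurjectiveModNGaloisRep p ∧
            (∀ q : ℕ, q.Prime → q ∣ V.conductorNorm ℤ → ¬ (p : ℤ) ∣ (q : ℤ) ^ 2 - 1) ∧
            ¬ p ∣ NumberField.classNumber K) ∧
        (Module.finrank ℚ K = 2 ∧ NumberField.IsTotallyComplex K ∧ NumberField.discr K < -4 ∧
            Int.gcd (NumberField.discr K) (V.conductorNorm ℤ * p) = 1) ∧
        (V.conductorNorm ℤ = Nplus * Nminus ∧ Nat.Coprime Nplus Nminus ∧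
            Odd Nminus.primeFactors.card ∧
            (∀ q : ℕ, q.Prime → q ∣ Nplus →
              ((Ideal.span {(q : ℤ)}).primesOver (NumberField.RingOfIntegers K)).ncard = 2) ∧
            (∀ q : ℕ, q.Prime → q ∣ Nminus →
              ((Ideal.span {(q : ℤ)}).primesOver (NumberField.RingOfIntegers K)).ncard = 1)) ∧
        (φ ≠ 0 ∧
          Literature.NumberTheory.Automorphic.Brandt.eigenLattice (Nplus * Nminus)
              (Literature.NumberTheory.Automorphic.Brandt.matrix S.O) (fun n => V.LFunction n) =
            Submodule.span ℤ {φ})) →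
      T.acOrderOfVanishing p φ
          (Literature.NumberTheory.EllipticCurves.padicUnitRoot p (V.LFunction p)) ≤
        ((max V.analyticRank (V.quadraticTwist (NumberField.discr K : ℚ)).analyticRank : ℕ) :
          ℕ∞) := by
  sorry

/-! ### Stub statements by name

The skeleton gate (`#h21_check_skeleton`) reads the composition's hypotheses BY NAME: each must be
a declared stub. The `abbrev`s below are the stubs' exact elaborated types (`type_of%`), so
`DefiniteExactOrder_of` takes `(h : Statement.stub_<name>)` and nothing else. -/

namespace Statement

/-- Statement of `stub_sharpAuxSupply`. -/
abbrev stub_sharpAuxSupply : Prop := type_of% @Birth.stub_sharpAuxSupply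
/-- Statement of `stub_brandtGrossRealisation`. -/
abbrev stub_brandtGrossRealisation : Prop := type_of% @Birth.stub_brandtGrossRealisation
/-- Statement of `stub_conj41UpperAnalytic`. -/
abbrev stub_conj41UpperAnalytic : Prop := type_of% @Birth.stub_conj41UpperAnalytic

end Statement

/-! ### The crux from the stubs (kernel-checked composition, no `sorry`) -/

/-- **The crux BY NAME from the three stub statements** (A1 → A2 → B →
`DefiniteTheta.DefiniteExactOrder`): A1 supplies `(p, N⁺, N⁻, K)` with the side conditions,
`Squarefree N⁻` and `r_an(V^{d_K}) ≤ r_an(V)`; A2 supplies `(S, T, φ)`; B gives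
`ord θ ≤ max (r_an V) (r_an V^{d_K}) = r_an V` in `ℕ∞`. [folklore] -/
theorem DefiniteExactOrder_of (hA1 : Statement.stub_sharpAuxSupply)
    (hA2 : Statement.stub_brandtGrossRealisation) (hB : Statement.stub_conj41UpperAnalytic) :
    DefiniteExactOrder := by
  intro V _ _ hm
  obtain ⟨p, hp, Nplus, Nminus, K, hFK, hNK, hP, hK, hN, hsq, htw⟩ := hA1 V hm
  obtain ⟨S, hFin, T, φ, hφ, hL⟩ :=
    hA2 V p Nplus Nminus K hP.2.1 hK.1 hK.2.1 hK.2.2.2 hN.1 hN.2.1 hsq hN.2.2.1 hN.2.2.2.1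
      hN.2.2.2.2
  refine ⟨p, hp, Nplus, Nminus, K, hFK, hNK, S, hFin, T, φ, ⟨hP, hK, hN, hφ, hL⟩, ?_⟩
  exact (hB V p Nplus Nminus K S T φ ⟨hP, hK, hN, hφ, hL⟩).trans
    (by exact_mod_cast (max_eq_left htw).le)

/-- The crux along this line (route `DefiniteTheta` decl, by name), MODULO exactly the three
registered stubs (depends on `sorryAx` only through `stub_*`). [folklore] -/
theorem DefiniteExactOrder_proof : DefiniteExactOrder :=
  DefiniteExactOrder_of stub_sharpAuxSupply stub_brandtGrossRealisation stub_conj41UpperAnalytic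

/-! ### What already discharges part of A2 (kernel-checked pointer, no `sorry`) -/

/-- The Brandt-setup third of A2 is a theorem in tree: under A2's hypotheses a setup of type
`(N⁺, N⁻)` exists (`Brandt.nonempty_xiSetup_iff_admissible`; `N⁺ ≥ 1` because `N_V ≥ 1`,
`conductorNorm_pos_holds`). [folklore] -/
theorem exists_xiSetup (V : WeierstrassCurve ℚ) [V.IsElliptic] {Nplus Nminus : ℕ}
    (hN : V.conductorNorm ℤ = Nplus * Nminus) (hcop : Nat.Coprime Nplus Nminus)
    (hsq : Squarefree Nminus) (hodd : Odd Nminus.primeFactors.card) :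
    Nonempty (Brandt.XiSetup Nplus Nminus) := by
  refine Brandt.nonempty_xiSetup_iff_admissible.mpr ⟨?_, hsq, hodd, hcop⟩
  rcases Nat.eq_zero_or_pos Nplus with h0 | h0
  · exact absurd hN (by rw [h0, zero_mul]; exact (V.conductorNorm_pos_holds).ne')
  · exact h0

end Summit.BirchSwinnertonDyer.BirchSwinnertonDyer.Cruxes.DefiniteExactOrder.Birth
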